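import Mathlib
import Literature.RingTheory.ZeroDimensional.IntegralShapeLemma
import HarnessLib

/-!
# Finite Fourier inversion on `(ℤ/m)ˣ` modulo `3` — the «no-holes span lemma» of E-es-87♭ (MEMO-es §36.5 step (4))

Summit `BirchSwinnertonDyer`, route `ManinLocalTwoThree` (cell bsd-f2-manin), crux C3 `ManinPrimeToThreeAtNine`
(stmt-BirchSwinnertonDyer-22968).  This file is the self-contained character-theoretic step of the Lean proof of es's
THEOREM (paper) E-es-87♭ `TameUnitTwistOfPlusIndexPrimeToThree` (HOME/es/Sketch-es-g22.lean §3, MEMO-es §36.5; typer ask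
T-es-29 (c), «prover-sized»):

* §1 `Int.dvd_of_isIntegral_intCast_div` — `n / p` an algebraic integer ⟹ `p ∣ n` (from the tree's «a rational algebraic
  integer is an integer», `Literature.RingTheory.ZeroDimensional.exists_int_of_isIntegral_ratCast`).
* §2 `DirichletCharacter.isIntegral_apply` — values of Dirichlet characters are algebraic integers.
* §3 `DirichletCharacter.sum_inv_mul_charSum_eq` — Fourier inversion `Σ_χ χ(b⁻¹)·F̂(χ) = φ(m)·F(b)` for
  `F̂(χ) = Σ_a χ(a) F(a)`; and the MOD-`p` SPAN LEMMA `Int.dvd_sub_of_forall_isIntegral_charSum_div`: if `p ∤ φ(m)` and for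
  every NON-TRIVIAL Dirichlet character `χ` mod `m` some `s` prime to `p` makes `s·F̂(χ)/p` an algebraic integer, then `F` is
  constant modulo `p` on the units.  In E-es-87♭ it is applied with `p = 3`, `m` a prime `≡ −1 (mod N)`, `3 ∣ N` (so
  `3 ∤ m − 1`), contrapositively: a balanced cusp difference with plus part `≢ 0 (mod 3Ω⁺)` yields a character `χ ≠ 1` with
  `s·F̂(χ)/3` never integral — avoiding prime ideals of `ℤ[ζ]` altogether (the memo's «3 unramified in `ℤ[ζ_n]`» step is replaced
  by clearing the prime-to-`3` multipliers `s_χ` and intersecting with `ℤ`).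

HONEST FRAMING: elementary algebra (orthogonality of characters, integrally closed `ℤ`); nothing about modular forms, C3,
Manin's conjecture or BSD is asserted or proved here.  No definitions, no named facts, no sorry.
-/

set_option linter.dupNamespace false
set_option autoImplicit false

noncomputable section

open scoped Classical

namespace Summit.BirchSwinnertonDyer.BirchSwinnertonDyer.Theorems.ManinLocalTwoThree

/-! ### §1 Rational algebraic integers -/

/-- If `n / p` is an algebraic integer for integers `n` and `p ≠ 0`, then `p ∣ n`. [folklore] -/
theorem Int.dvd_of_isIntegral_intCast_div {n p : ℤ} (hp : p ≠ 0) (h : IsIntegral ℤ ((n : ℂ) / (p : ℂ))) : p ∣ n := by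
  have e : ((n : ℂ) / (p : ℂ)) = (((n : ℚ) / (p : ℚ) : ℚ) : ℂ) := by push_cast; rfl
  rw [e] at h
  obtain ⟨z, hz⟩ := Literature.RingTheory.ZeroDimensional.exists_int_of_isIntegral_ratCast h
  have hpQ : (p : ℚ) ≠ 0 := by exact_mod_cast hp
  refine ⟨z, ?_⟩
  have : (n : ℚ) = p * z := by rw [hz]; field_simp
  exact_mod_cast this

/-! ### §2 Character values are algebraic integers -/

/-- Every value of a Dirichlet character is an algebraic integer (a root of unity or `0`). [folklore] -/
theorem DirichletCharacter.isIntegral_apply {m : ℕ} [NeZero m] (χ : DirichletCharacter ℂ m) (a : ZMod m) :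
    IsIntegral ℤ (χ a) := by
  by_cases ha : IsUnit a
  · obtain ⟨u, rfl⟩ := ha
    have hpow : (χ u) ^ m.totient = 1 := by
      rw [← map_pow, ← Units.val_pow_eq_pow_val, ZMod.pow_totient, Units.val_one, map_one]
    exact IsIntegral.of_pow (Nat.totient_pos.mpr (NeZero.pos m)) (hpow ▸ isIntegral_one)
  · rw [χ.map_nonunit ha]
    exact isIntegral_zero

/-! ### §3 Fourier inversion and the mod-`p` span lemma -/

/-- **Fourier inversion on `(ℤ/m)ˣ`**: `Σ_χ χ(b⁻¹) · (Σ_a χ(a) F(a)) = φ(m) · F(b)` for a unit `b`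
(orthogonality `DirichletCharacter.sum_char_inv_mul_char_eq`). [folklore] -/
theorem DirichletCharacter.sum_inv_mul_charSum_eq {m : ℕ} [NeZero m] (F : ZMod m → ℂ) {b : ZMod m}
    (hb : IsUnit b) :
    ∑ χ : DirichletCharacter ℂ m, χ b⁻¹ * ∑ a : ZMod m, χ a * F a = (m.totient : ℂ) * F b := by
  calc ∑ χ : DirichletCharacter ℂ m, χ b⁻¹ * ∑ a : ZMod m, χ a * F a
      = ∑ a : ZMod m, (∑ χ : DirichletCharacter ℂ m, χ b⁻¹ * χ a) * F a := by
        simp_rw [Finset.mul_sum, ← mul_assoc]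
        rw [Finset.sum_comm]
        simp_rw [Finset.sum_mul]
    _ = ∑ a : ZMod m, (if b = a then (m.totient : ℂ) else 0) * F a := by
        simp_rw [DirichletCharacter.sum_char_inv_mul_char_eq ℂ hb]
    _ = (m.totient : ℂ) * F b := by
        simp_rw [ite_mul, zero_mul]
        rw [Finset.sum_ite_eq]
        simp

/-- **The mod-`p` span lemma (finite Fourier inversion, «no holes»).**  Let `p` be a prime with `p ∤ φ(m)` and
`F : ℤ/m → ℤ`.  If for every non-trivial Dirichlet character `χ` mod `m` there is `s ∈ ℕ` with `p ∤ s` such that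
`s · (Σ_a χ(a) F(a)) / p` is an algebraic integer, then `p ∣ F(b) − F(b')` for all units `b, b'`.
Proof: clear the multipliers (`S = ∏ s_χ`, `p ∤ S`), Fourier-invert `φ(m)(F(b) − F(b')) = Σ_{χ ≠ 1} (χ(b⁻¹) − χ(b'⁻¹)) F̂(χ)`
(the `χ = 1` term vanishes), so `S φ(m) (F(b) − F(b')) / p` is a rational algebraic integer. [folklore] -/
theorem Int.dvd_sub_of_forall_isIntegral_charSum_div {m : ℕ} [NeZero m] {p : ℕ} (hp : p.Prime)
    (hpm : ¬ p ∣ m.totient) (F : ZMod m → ℤ)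
    (h : ∀ χ : DirichletCharacter ℂ m, χ ≠ 1 →
      ∃ s : ℕ, ¬ p ∣ s ∧ IsIntegral ℤ ((s : ℂ) * (∑ a : ZMod m, χ a * (F a : ℂ)) / p))
    {b b' : ZMod m} (hb : IsUnit b) (hb' : IsUnit b') : (p : ℤ) ∣ F b - F b' := by
  -- one multiplier for all characters
  have h1 : ∀ χ : DirichletCharacter ℂ m, ∃ s : ℕ, ¬ p ∣ s ∧
      (χ ≠ 1 → IsIntegral ℤ ((s : ℂ) * (∑ a : ZMod m, χ a * (F a : ℂ)) / p)) := by
    intro χ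
    by_cases hχ : χ = 1
    · exact ⟨1, hp.one_lt.ne' ∘ Nat.dvd_one.mp, fun h1 ↦ (h1 hχ).elim⟩
    · obtain ⟨s, hs, hI⟩ := h χ hχ
      exact ⟨s, hs, fun _ ↦ hI⟩
  choose s hs hI using h1
  set S : ℕ := ∏ χ : DirichletCharacter ℂ m, s χ with hS
  have hpS : ¬ p ∣ S := by
    rw [hS, Prime.dvd_finsetProd_iff hp.prime]
    rintro ⟨χ, -, hχ⟩
    exact hs χ hχ
  have hSI : ∀ χ : DirichletCharacter ℂ m, χ ≠ 1 →
      IsIntegral ℤ ((S : ℂ) * (∑ a : ZMod m, χ a * (F a : ℂ)) / p) := by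
    intro χ hχ
    have e : ((S : ℂ) * (∑ a : ZMod m, χ a * (F a : ℂ)) / p) =
        ((∏ ψ ∈ (Finset.univ.erase χ), s ψ : ℕ) : ℂ) * ((s χ : ℂ) * (∑ a : ZMod m, χ a * (F a : ℂ)) / p) := by
      rw [hS, ← Finset.mul_prod_erase Finset.univ s (Finset.mem_univ χ)]
      push_cast
      ring
    rw [e]
    have hnat : ∀ K : ℕ, IsIntegral ℤ ((K : ℕ) : ℂ) := fun K ↦ by
      simpa using isIntegral_algebraMap (R := ℤ) (A := ℂ) (x := (K : ℤ))
    exact IsIntegral.mul (hnat _) (hI χ hχ)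
  -- Fourier inversion for `b` and `b'`
  have hFb := DirichletCharacter.sum_inv_mul_charSum_eq (fun a ↦ (F a : ℂ)) hb
  have hFb' := DirichletCharacter.sum_inv_mul_charSum_eq (fun a ↦ (F a : ℂ)) hb'
  -- the algebraic integer `α = Σ_χ (χ b⁻¹ − χ b'⁻¹) · (S F̂ χ / p)`
  set α : ℂ := ∑ χ : DirichletCharacter ℂ m,
    (χ b⁻¹ - χ b'⁻¹) * ((S : ℂ) * (∑ a : ZMod m, χ a * (F a : ℂ)) / p) with hα
  have hαI : IsIntegral ℤ α := by
    refine IsIntegral.sum _ fun χ _ ↦ ?_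
    by_cases hχ : χ = 1
    · subst hχ
      have hu : IsUnit b⁻¹ := by
        obtain ⟨u, rfl⟩ := hb; rw [ZMod.inv_coe_unit]; exact Units.isUnit _
      have hu' : IsUnit b'⁻¹ := by
        obtain ⟨u, rfl⟩ := hb'; rw [ZMod.inv_coe_unit]; exact Units.isUnit _
      rw [MulChar.one_apply hu, MulChar.one_apply hu', sub_self, zero_mul]
      exact isIntegral_zero
    · exact IsIntegral.mul ((DirichletCharacter.isIntegral_apply χ _).sub
        (DirichletCharacter.isIntegral_apply χ _)) (hSI χ hχ)
  -- `S · φ(m) · (F b − F b') = p · α`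
  have hp0 : (p : ℂ) ≠ 0 := by exact_mod_cast hp.ne_zero
  have key : (((S : ℤ) * (m.totient : ℤ) * (F b - F b') : ℤ) : ℂ) / (p : ℤ) = α := by
    have e1 : α = (S : ℂ) / p * (∑ χ : DirichletCharacter ℂ m, χ b⁻¹ * ∑ a : ZMod m, χ a * (F a : ℂ)) -
        (S : ℂ) / p * (∑ χ : DirichletCharacter ℂ m, χ b'⁻¹ * ∑ a : ZMod m, χ a * (F a : ℂ)) := by
      rw [hα, Finset.mul_sum, Finset.mul_sum, ← Finset.sum_sub_distrib]
      refine Finset.sum_congr rfl fun χ _ ↦ ?_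
      field_simp
    rw [e1, hFb, hFb']
    push_cast
    field_simp
  have hdvd : (p : ℤ) ∣ (S : ℤ) * (m.totient : ℤ) * (F b - F b') :=
    Int.dvd_of_isIntegral_intCast_div (by exact_mod_cast hp.ne_zero) (key ▸ hαI)
  -- remove the prime-to-`p` factors
  have hpZ : Prime (p : ℤ) := Nat.prime_iff_prime_int.mp hp
  rcases hpZ.dvd_or_dvd hdvd with h1 | h1
  · rcases hpZ.dvd_or_dvd h1 with h2 | h2
    · exact absurd (Int.natCast_dvd_natCast.mp h2) hpS
    · exact absurd (Int.natCast_dvd_natCast.mp h2) hpm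
  · exact h1


/-! ### §4 The RELATIVE span lemma (Φ_H for a cyclic `H = ⟨h⟩`; appended for THEOREM U, MEMO-es §36.11 (1)) -/

/-- **The relative mod-`p` span lemma (Φ_H, `H = ⟨h⟩`).**  Let `p` be a prime with `p ∤ φ(m)`, `F : ℤ/m → ℤ` and `h` a
unit of `ℤ/m`.  If for every Dirichlet character `χ` mod `m` with `χ(h) ≠ 1` there is `s ∈ ℕ`, `p ∤ s`, with
`s · (Σ_a χ(a) F(a)) / p` an algebraic integer, then `p ∣ F(h·b) − F(b)` for every unit `b`: `F` is constant modulo `p` on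
the cosets of `⟨h⟩`.  Proof: clear the multipliers, Fourier-invert
`φ(m)(F(hb) − F(b)) = Σ_χ (χ((hb)⁻¹) − χ(b⁻¹)) F̂(χ)`; the characters with `χ(h) = 1` drop out since then
`χ((hb)⁻¹) = χ(b⁻¹)`. [folklore] -/
theorem Int.dvd_sub_of_forall_isIntegral_charSum_div_of_apply_ne_one {m : ℕ} [NeZero m] {p : ℕ} (hp : p.Prime)
    (hpm : ¬ p ∣ m.totient) (F : ZMod m → ℤ) {h : ZMod m} (hh : IsUnit h)
    (hH : ∀ χ : DirichletCharacter ℂ m, χ h ≠ 1 →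
      ∃ s : ℕ, ¬ p ∣ s ∧ IsIntegral ℤ ((s : ℂ) * (∑ a : ZMod m, χ a * (F a : ℂ)) / p))
    {b : ZMod m} (hb : IsUnit b) : (p : ℤ) ∣ F (h * b) - F b := by
  -- one multiplier for all characters
  have h1 : ∀ χ : DirichletCharacter ℂ m, ∃ s : ℕ, ¬ p ∣ s ∧
      (χ h ≠ 1 → IsIntegral ℤ ((s : ℂ) * (∑ a : ZMod m, χ a * (F a : ℂ)) / p)) := by
    intro χ
    by_cases hχ : χ h = 1
    · exact ⟨1, hp.one_lt.ne' ∘ Nat.dvd_one.mp, fun h1 ↦ (h1 hχ).elim⟩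
    · obtain ⟨s, hs, hI⟩ := hH χ hχ
      exact ⟨s, hs, fun _ ↦ hI⟩
  choose s hs hI using h1
  set S : ℕ := ∏ χ : DirichletCharacter ℂ m, s χ with hS
  have hpS : ¬ p ∣ S := by
    rw [hS, Prime.dvd_finsetProd_iff hp.prime]
    rintro ⟨χ, -, hχ⟩
    exact hs χ hχ
  have hSI : ∀ χ : DirichletCharacter ℂ m, χ h ≠ 1 →
      IsIntegral ℤ ((S : ℂ) * (∑ a : ZMod m, χ a * (F a : ℂ)) / p) := by
    intro χ hχ
    have e : ((S : ℂ) * (∑ a : ZMod m, χ a * (F a : ℂ)) / p) =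
        ((∏ ψ ∈ (Finset.univ.erase χ), s ψ : ℕ) : ℂ) * ((s χ : ℂ) * (∑ a : ZMod m, χ a * (F a : ℂ)) / p) := by
      rw [hS, ← Finset.mul_prod_erase Finset.univ s (Finset.mem_univ χ)]
      push_cast
      ring
    rw [e]
    have hnat : ∀ K : ℕ, IsIntegral ℤ ((K : ℕ) : ℂ) := fun K ↦ by
      simpa using isIntegral_algebraMap (R := ℤ) (A := ℂ) (x := (K : ℤ))
    exact IsIntegral.mul (hnat _) (hI χ hχ)
  -- units
  obtain ⟨u, rfl⟩ := hh
  obtain ⟨v, rfl⟩ := hb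
  have huv : IsUnit ((u : ZMod m) * (v : ZMod m)) := by rw [← Units.val_mul]; exact Units.isUnit _
  -- Fourier inversion for `h b` and `b`
  have hFhb := DirichletCharacter.sum_inv_mul_charSum_eq (fun a ↦ (F a : ℂ)) huv
  have hFb := DirichletCharacter.sum_inv_mul_charSum_eq (fun a ↦ (F a : ℂ)) (Units.isUnit v)
  -- characters trivial on `h` drop out
  have hdrop : ∀ χ : DirichletCharacter ℂ m, χ (u : ZMod m) = 1 →
      χ ((u : ZMod m) * (v : ZMod m))⁻¹ = χ (v : ZMod m)⁻¹ := by
    intro χ hχ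
    have hinv : χ ((u⁻¹ : (ZMod m)ˣ) : ZMod m) = 1 := by
      have := map_mul χ ((u⁻¹ : (ZMod m)ˣ) : ZMod m) (u : ZMod m)
      rw [← Units.val_mul, inv_mul_cancel, Units.val_one, map_one, hχ, mul_one] at this
      exact this.symm
    rw [← Units.val_mul, ZMod.inv_coe_unit, ZMod.inv_coe_unit, mul_inv_rev, Units.val_mul, map_mul, hinv, mul_one]
  -- the algebraic integer `α = Σ_χ (χ (hb)⁻¹ − χ b⁻¹) · (S F̂ χ / p)`
  set α : ℂ := ∑ χ : DirichletCharacter ℂ m,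
    (χ ((u : ZMod m) * (v : ZMod m))⁻¹ - χ (v : ZMod m)⁻¹) * ((S : ℂ) * (∑ a : ZMod m, χ a * (F a : ℂ)) / p)
    with hα
  have hαI : IsIntegral ℤ α := by
    refine IsIntegral.sum _ fun χ _ ↦ ?_
    by_cases hχ : χ (u : ZMod m) = 1
    · rw [hdrop χ hχ, sub_self, zero_mul]
      exact isIntegral_zero
    · exact IsIntegral.mul ((DirichletCharacter.isIntegral_apply χ _).sub
        (DirichletCharacter.isIntegral_apply χ _)) (hSI χ hχ)
  -- `S · φ(m) · (F (h b) − F b) = p · α`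
  have hp0 : (p : ℂ) ≠ 0 := by exact_mod_cast hp.ne_zero
  have key : (((S : ℤ) * (m.totient : ℤ) * (F ((u : ZMod m) * (v : ZMod m)) - F (v : ZMod m)) : ℤ) : ℂ) / (p : ℤ)
      = α := by
    have e1 : α = (S : ℂ) / p *
        (∑ χ : DirichletCharacter ℂ m, χ ((u : ZMod m) * (v : ZMod m))⁻¹ * ∑ a : ZMod m, χ a * (F a : ℂ)) -
        (S : ℂ) / p * (∑ χ : DirichletCharacter ℂ m, χ (v : ZMod m)⁻¹ * ∑ a : ZMod m, χ a * (F a : ℂ)) := by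
      rw [hα, Finset.mul_sum, Finset.mul_sum, ← Finset.sum_sub_distrib]
      refine Finset.sum_congr rfl fun χ _ ↦ ?_
      field_simp
    rw [e1, hFhb, hFb]
    push_cast
    field_simp
  have hdvd : (p : ℤ) ∣ (S : ℤ) * (m.totient : ℤ) * (F ((u : ZMod m) * (v : ZMod m)) - F (v : ZMod m)) :=
    Int.dvd_of_isIntegral_intCast_div (by exact_mod_cast hp.ne_zero) (key ▸ hαI)
  have hpZ : Prime (p : ℤ) := Nat.prime_iff_prime_int.mp hp
  rcases hpZ.dvd_or_dvd hdvd with h1 | h1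
  · rcases hpZ.dvd_or_dvd h1 with h2 | h2
    · exact absurd (Int.natCast_dvd_natCast.mp h2) hpS
    · exact absurd (Int.natCast_dvd_natCast.mp h2) hpm
  · exact h1

end Summit.BirchSwinnertonDyer.BirchSwinnertonDyer.Theorems.ManinLocalTwoThree

end
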